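import Mathlib
import Literature.Probability.LatticeModels.TorusGreenHeatKernel
import Summits.QuantumFields.BalabanUV.T4Continuum.Support.SliceFlatHeatTorus

/-!
# `BalabanUV.Beta.FP.TorusHeatSemigroup` — road «FP» (binder row D1), lane IR-5′, FILE B-a of the `hAB` plan: the PRODUCT HEAT KERNEL of the
# cubic torus `(ℤ/Λ)^D` is a CONVOLUTION SEMIGROUP with `ℓ¹`-bounded unit differences, hence its second and third mixed differences have
# `ℓ¹` norms `≤ C²(1∨s)⁻¹`, `≤ C³(1∨s)^{−3/2}` — from the tree's FIRST-difference bound alone (`‖D^kP_{3s}‖₁ ≤ Π‖DP_s‖₁`, Young)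

HONEST DEPENDENCY (page 1, mandatory): continuum YM on T⁴ ⇐ BetaPertH ∧ nine spine estimates (0/9 proved); BetaPertH ⇐ (D1) ∧ (D4) ∧
CAP+tail; G-an2-4 gates asym, D1 and NE2/3/4.  HONEST FRAMING (cell contract, verbatim): «discharging `BetaPertH` makes Bałaban's UV
stability UNCONDITIONAL — a real constructive-QFT result; it is NOT the continuum limit and NOT the Clay problem.»  THIS MODULE is [folklore]
finite Fourier analysis on `(ℤ/Λ)^D` over the tree's torus heat kernel `TorusHeatKernel1D.torusHeatKernel` (`q^Λ_s`), its character expansion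
(`TorusGreenHeatKernel`, `TorusFourierProofs.torusChar`) and t4-ne3-p1's `ℓ¹` bounds `SliceFlatHeatTorus.weighted_sum_torusHeatKernel_le` ∕
`weighted_sum_fwdDiff_torusHeatKernel_le` read at weight `β = 0` (`Σ_c|q^Λ_s(c)| ≤ 48`, `Σ_c|q^Λ_s(c+1) − q^Λ_s(c)| ≤ 1260·(1∨s)^{−1∕2}`, uniform in `Λ`).
It cites nothing as a hypothesis, mints no `Prop`, has no `def`, 0 sorry.  Nothing here is specific to a gauge theory.  NOT hAB, NOT (T1′), NOT D1,
NOT BetaPertH, NOT continuum, NOT Clay.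

ABSOLUTE RULE (cell charter, verbatim): «No internally-minted statement may enter as a cited fact. Every hypothesis is either kernel-proved in this
package or a verbatim quotation of a PUBLISHED theorem with page reference. The manuscript(s) under audit are NOT citable for their own disputed
steps — they are the thing under adjudication; programme-internal (2001/route/tribunal) claims are never citable.»

CONTENT (the kernel `K_s(z) = Π_i q^Λ_s(z_i)` is written out, no `def`).  §1 `ofReal_prodHeat` (complex character form `Λ^{−D}Σ_k χ_k(z)e^{−sε_k}`),
**`prodHeat_conv`** (`Σ_w K_s(z − w)K_t(w) = K_{s+t}(z)`, character orthogonality); §2 `sum_abs_conv_le` (Young on the finite torus), `fwdDiff_conv` ∕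
`bwdDiff_conv` (differences commute with convolution); §3 `sum_abs_prodHeat_le` (`≤ 48^D`), **`sum_abs_fwdDiff_prodHeat_le`** ∕ `…bwdDiff…`
(`≤ 1260·48^D·(1∨s)^{−1∕2}`, the product structure `prod_univ_sum`); §4 **`sum_abs_diff₂_prodHeat_le`** (`Σ_z|D_νD_μK_{2s}(z)| ≤ (1260·48^D)²·(1∨s)⁻¹`) and
**`sum_abs_diff₃_prodHeat_le`** (`Σ_z|D_νD_μD⁻_{μ′}K_{3s}(z)| ≤ (1260·48^D)³·(1∨s)^{−3∕2}`).  FILE B-b (`FreeBiResolventRowDiff`) integrates these against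
`u e^{−u}` to bound the two FREE letters of `GaugeFactorRowDiffSocket`.
Unit `b2b-balaban-beta-d1-formalise-leaf-05` (gen 23), 2026-08-21; `LEAVES-FP.md` row «(T1′) SOCKET» (plan `HOME/…/leaf-05/g23/hAB-PLAN.md` v2).
-/

noncomputable section

open scoped BigOperators ComplexConjugate
open Finset

namespace Summit.QuantumFields.BalabanUV.Beta.FP.TorusHeatSemigroup

open Literature.Probability.LatticeModels
open Summit.QuantumFields.BalabanUV.T4Continuum.SliceFlatHeatTorus (weighted_sum_torusHeatKernel_le weighted_sum_fwdDiff_torusHeatKernel_le)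

variable {D Λ : ℕ} [NeZero Λ]

/-! ## §1 The complex character form and the convolution semigroup -/

/-- [folklore] `(Π_i q^Λ_s(z_i) : ℂ) = Λ^{−D}·Σ_k χ_k(z)·e^{−sε(p_k)}` (coordinatewise Fourier form of `torusHeatKernel`, characters factorise). -/
theorem ofReal_prodHeat (s : ℝ) (z : TorusSite D Λ) :
    ((∏ i, torusHeatKernel s (z i) : ℝ) : ℂ)
      = (((Λ : ℂ) ^ D)⁻¹) * ∑ k : TorusSite D Λ, torusChar k z * ((Real.exp (-(s * dispersion (latticeMomentum Λ k))) : ℝ) : ℂ) := by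
  classical
  rw [Complex.ofReal_prod]
  simp_rw [ofReal_torusHeatKernel, torusChar_mul_exp_eq_prod]
  rw [Finset.prod_div_distrib, Finset.prod_const, Finset.card_univ, Fintype.card_fin, div_eq_inv_mul, Finset.prod_univ_sum]
  simp only [Fintype.piFinset_univ]

/-- [folklore] character orthogonality in the form `Σ_w χ_k(z − w)·χ_{k′}(w) = [k = k′]·Λ^D·χ_k(z)`. -/
theorem sum_torusChar_sub_mul (k k' z : TorusSite D Λ) :
    ∑ w : TorusSite D Λ, torusChar k (z - w) * torusChar k' w = if k' = k then (Λ : ℂ) ^ D * torusChar k z else 0 := by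
  have e : ∀ w, torusChar k (z - w) * torusChar k' w = torusChar k z * torusChar (k' - k) w := fun w => by
    rw [torusChar_sub_right, torusChar_sub_left]; ring
  simp_rw [e]
  rw [← Finset.mul_sum, sum_torusChar_right]
  by_cases h : k' = k
  · subst h; simp [mul_comm]
  · rw [if_neg (sub_ne_zero.mpr h), if_neg h, mul_zero]

/-- [folklore] **THE PRODUCT HEAT KERNEL IS A CONVOLUTION SEMIGROUP**: `Σ_w K_s(z − w)·K_t(w) = K_{s+t}(z)`, `K_s(z) = Π_i q^Λ_s(z_i)`. -/
theorem prodHeat_conv (s t : ℝ) (z : TorusSite D Λ) :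
    ∑ w : TorusSite D Λ, (∏ i, torusHeatKernel s ((z - w) i)) * (∏ i, torusHeatKernel t (w i)) = ∏ i, torusHeatKernel (s + t) (z i) := by
  classical
  -- abbreviations for the mode weights
  set a : TorusSite D Λ → ℂ := fun k => ((Real.exp (-(s * dispersion (latticeMomentum Λ k))) : ℝ) : ℂ) with ha
  set b : TorusSite D Λ → ℂ := fun k => ((Real.exp (-(t * dispersion (latticeMomentum Λ k))) : ℝ) : ℂ) with hb
  set c : ℂ := ((Λ : ℂ) ^ D)⁻¹ with hc
  have hΛ : ((Λ : ℂ) ^ D) ≠ 0 := natCast_pow_ne_zero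
  have hs' : ∀ w : TorusSite D Λ, ((∏ i, torusHeatKernel s ((z - w) i) : ℝ) : ℂ) = c * ∑ k, torusChar k (z - w) * a k := fun w => ofReal_prodHeat s (z - w)
  have ht' : ∀ w : TorusSite D Λ, ((∏ i, torusHeatKernel t (w i) : ℝ) : ℂ) = c * ∑ k', torusChar k' w * b k' := fun w => ofReal_prodHeat t w
  have hst : ((∏ i, torusHeatKernel (s + t) (z i) : ℝ) : ℂ) = c * ∑ k, torusChar k z * (a k * b k) := by
    rw [ofReal_prodHeat]
    refine congrArg (c * ·) (Finset.sum_congr rfl fun k _ => ?_)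
    rw [ha, hb, add_mul, neg_add, Real.exp_add, Complex.ofReal_mul]
  have key : ((∑ w : TorusSite D Λ, (∏ i, torusHeatKernel s ((z - w) i)) * (∏ i, torusHeatKernel t (w i)) : ℝ) : ℂ)
      = ((∏ i, torusHeatKernel (s + t) (z i) : ℝ) : ℂ) := by
    rw [Complex.ofReal_sum, hst]
    simp_rw [Complex.ofReal_mul, hs', ht']
    -- Σ_w (c Σ_k χ_k(z−w) a_k)(c Σ_k' χ_k'(w) b_k') = c·c·Σ_k Σ_k' a_k b_k' Σ_w χ_k(z−w)χ_k'(w)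
    have e1 : ∀ w : TorusSite D Λ, (c * ∑ k, torusChar k (z - w) * a k) * (c * ∑ k', torusChar k' w * b k')
        = c * c * ∑ k, ∑ k', a k * b k' * (torusChar k (z - w) * torusChar k' w) := by
      intro w
      rw [show c * (∑ k, torusChar k (z - w) * a k) * (c * ∑ k', torusChar k' w * b k')
          = c * c * ((∑ k, torusChar k (z - w) * a k) * ∑ k', torusChar k' w * b k') by ring, Finset.sum_mul_sum]
      congr 1
      exact Finset.sum_congr rfl fun k _ => Finset.sum_congr rfl fun k' _ => by ring
    simp_rw [e1]
    rw [← Finset.mul_sum, Finset.sum_comm]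
    -- now c*c*Σ_k Σ_w Σ_k' …  → evaluate Σ_w first
    have e2 : ∀ k : TorusSite D Λ, ∑ w : TorusSite D Λ, ∑ k', a k * b k' * (torusChar k (z - w) * torusChar k' w)
        = a k * b k * ((Λ : ℂ) ^ D * torusChar k z) := by
      intro k
      rw [Finset.sum_comm]
      have e3 : ∀ k', ∑ w : TorusSite D Λ, a k * b k' * (torusChar k (z - w) * torusChar k' w)
          = a k * b k' * (if k' = k then (Λ : ℂ) ^ D * torusChar k z else 0) := fun k' => by
        rw [← Finset.mul_sum, sum_torusChar_sub_mul]
      simp_rw [e3, mul_ite, mul_zero]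
      rw [Finset.sum_ite_eq' Finset.univ k]
      simp
    simp_rw [e2]
    rw [Finset.mul_sum, Finset.mul_sum]
    refine Finset.sum_congr rfl fun k _ => ?_
    rw [hc]
    field_simp
  exact Complex.ofReal_injective key

/-! ## §2 Convolution on the finite torus: Young's inequality, differences commute -/

/-- [folklore] **YOUNG ON THE FINITE TORUS**: `Σ_z |Σ_w f(z − w)g(w)| ≤ (Σ|f|)·(Σ|g|)`. -/
theorem sum_abs_conv_le (f g : TorusSite D Λ → ℝ) :
    ∑ z : TorusSite D Λ, |∑ w, f (z - w) * g w| ≤ (∑ z, |f z|) * (∑ w, |g w|) := by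
  calc ∑ z : TorusSite D Λ, |∑ w, f (z - w) * g w| ≤ ∑ z, ∑ w, |f (z - w)| * |g w| :=
        Finset.sum_le_sum fun z _ => (Finset.abs_sum_le_sum_abs _ _).trans (by simp only [abs_mul]; exact le_rfl)
    _ = ∑ w, |g w| * ∑ z, |f (z - w)| := by
        rw [Finset.sum_comm]; exact Finset.sum_congr rfl fun w _ => by rw [Finset.mul_sum]; exact Finset.sum_congr rfl fun z _ => mul_comm _ _
    _ = ∑ w, |g w| * ∑ z, |f z| := Finset.sum_congr rfl fun w _ => by
        rw [show ∑ z, |f (z - w)| = ∑ z, |f z| from Equiv.sum_comp (Equiv.subRight w) (fun z => |f z|)]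
    _ = (∑ z, |f z|) * (∑ w, |g w|) := by rw [← Finset.sum_mul, mul_comm]

/-- [folklore] a forward difference of a convolution is the convolution of the forward difference. -/
theorem fwdDiff_conv (f g : TorusSite D Λ → ℝ) (e z : TorusSite D Λ) :
    (∑ w, f (z + e - w) * g w) - (∑ w, f (z - w) * g w) = ∑ w, (f (z - w + e) - f (z - w)) * g w := by
  rw [← Finset.sum_sub_distrib]
  exact Finset.sum_congr rfl fun w _ => by rw [show z + e - w = z - w + e by abel]; ring

/-- [folklore] the same for the convolution written with the difference in the SECOND factor's variable: `Σ_w f(z−w)g(w)` with `z ↦ z + e` equals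
`Σ_w f(z − w)·g(w + e)`. -/
theorem conv_shift (f g : TorusSite D Λ → ℝ) (e z : TorusSite D Λ) :
    ∑ w, f (z + e - w) * g w = ∑ w, f (z - w) * g (w + e) := by
  rw [← Equiv.sum_comp (Equiv.addRight e) (fun w => f (z + e - w) * g w)]
  exact Finset.sum_congr rfl fun w _ => by simp only [Equiv.coe_addRight, add_sub_add_right_eq_sub]

/-- [folklore] reindexing: `Σ_z |h(z + e)| = Σ_z |h z|`. -/
theorem sum_abs_shift (h : TorusSite D Λ → ℝ) (e : TorusSite D Λ) : ∑ z, |h (z + e)| = ∑ z, |h z| :=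
  Equiv.sum_comp (Equiv.addRight e) (fun z => |h z|)

/-! ## §3 `ℓ¹` bounds of the product kernel and of its unit differences -/

/-- [folklore] `Σ_c |q^Λ_s(c)| ≤ 48` (t4-ne3-p1's weighted bound at weight zero). -/
theorem sum_abs_torusHeatKernel_le {s : ℝ} (hs : 0 < s) : ∑ c : ZMod Λ, |torusHeatKernel s c| ≤ 48 := by
  have h := weighted_sum_torusHeatKernel_le (P := Λ) hs le_rfl (by norm_num : (0 : ℝ) ≤ 1 / 16)
  simpa using h

/-- [folklore] `Σ_c |q^Λ_s(c+1) − q^Λ_s(c)| ≤ 1260·(1∨s)^{−1∕2}` (t4-ne3-p1's weighted bound at weight zero). -/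
theorem sum_abs_fwdDiff_torusHeatKernel_le {s : ℝ} (hs : 0 < s) :
    ∑ c : ZMod Λ, |torusHeatKernel s (c + 1) - torusHeatKernel s c| ≤ 1260 * (max 1 s) ^ (-(1 / 2 : ℝ)) := by
  have h := weighted_sum_fwdDiff_torusHeatKernel_le (P := Λ) hs le_rfl (by norm_num : (0 : ℝ) ≤ 1 / 32)
  simpa using h

/-- [folklore] `Σ_{z ∈ (ℤ/Λ)^D} Π_i |g_i(z_i)| = Π_i Σ_c |g_i(c)|`. -/
theorem sum_prod_abs_eq (g : Fin D → ZMod Λ → ℝ) :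
    ∑ z : TorusSite D Λ, ∏ i, |g i (z i)| = ∏ i, ∑ c : ZMod Λ, |g i c| := by
  classical
  rw [Finset.prod_univ_sum]
  simp only [Fintype.piFinset_univ]

/-- [folklore] `Σ_z |K_s(z)| ≤ 48^D`. -/
theorem sum_abs_prodHeat_le {s : ℝ} (hs : 0 < s) : ∑ z : TorusSite D Λ, |∏ i, torusHeatKernel s (z i)| ≤ (48 : ℝ) ^ D := by
  calc ∑ z : TorusSite D Λ, |∏ i, torusHeatKernel s (z i)| = ∑ z : TorusSite D Λ, ∏ i, |torusHeatKernel s (z i)| :=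
        Finset.sum_congr rfl fun z _ => Finset.abs_prod _ _
    _ = ∏ i : Fin D, ∑ c : ZMod Λ, |torusHeatKernel s c| := sum_prod_abs_eq (fun _ c => torusHeatKernel s c)
    _ ≤ ∏ _i : Fin D, (48 : ℝ) := Finset.prod_le_prod (fun i _ => Finset.sum_nonneg fun c _ => abs_nonneg _) fun i _ => sum_abs_torusHeatKernel_le hs
    _ = 48 ^ D := by rw [Finset.prod_const, Finset.card_univ, Fintype.card_fin]

/-- [folklore] **THE FORWARD DIFFERENCE OF THE PRODUCT KERNEL IN `ℓ¹`**: `Σ_z |K_s(z + e_ν) − K_s(z)| ≤ 1260·48^D·(1∨s)^{−1∕2}`. -/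
theorem sum_abs_fwdDiff_prodHeat_le {s : ℝ} (hs : 0 < s) (ν : Fin D) :
    ∑ z : TorusSite D Λ, |(∏ i, torusHeatKernel s ((z + Pi.single ν 1 : TorusSite D Λ) i)) - ∏ i, torusHeatKernel s (z i)|
      ≤ 1260 * (48 : ℝ) ^ D * (max 1 s) ^ (-(1 / 2 : ℝ)) := by
  classical
  -- factorise the difference: only the ν-th factor changes
  set g : Fin D → ZMod Λ → ℝ := fun i c => if i = ν then torusHeatKernel s (c + 1) - torusHeatKernel s c else torusHeatKernel s c with hg
  have hfac : ∀ z : TorusSite D Λ, (∏ i, torusHeatKernel s ((z + Pi.single ν 1 : TorusSite D Λ) i)) - ∏ i, torusHeatKernel s (z i) = ∏ i, g i (z i) := by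
    intro z
    rw [← Finset.mul_prod_erase _ _ (Finset.mem_univ ν), ← Finset.mul_prod_erase Finset.univ (fun i => torusHeatKernel s (z i)) (Finset.mem_univ ν),
      ← Finset.mul_prod_erase Finset.univ (fun i => g i (z i)) (Finset.mem_univ ν)]
    have h1 : (z + Pi.single ν 1 : TorusSite D Λ) ν = z ν + 1 := by simp
    have h2 : ∏ i ∈ Finset.univ.erase ν, torusHeatKernel s ((z + Pi.single ν 1 : TorusSite D Λ) i) = ∏ i ∈ Finset.univ.erase ν, torusHeatKernel s (z i) :=
      Finset.prod_congr rfl fun i hi => by rw [Pi.add_apply, Pi.single_eq_of_ne (Finset.ne_of_mem_erase hi), add_zero]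
    have h3 : ∏ i ∈ Finset.univ.erase ν, g i (z i) = ∏ i ∈ Finset.univ.erase ν, torusHeatKernel s (z i) :=
      Finset.prod_congr rfl fun i hi => by rw [hg]; simp only [Finset.ne_of_mem_erase hi, if_false]
    have h4 : g ν (z ν) = torusHeatKernel s (z ν + 1) - torusHeatKernel s (z ν) := by rw [hg]; simp only [if_true]
    rw [h1, h2, h3, h4]; ring
  simp_rw [hfac, Finset.abs_prod]
  rw [sum_prod_abs_eq g, ← Finset.mul_prod_erase _ _ (Finset.mem_univ ν)]
  have hν : ∑ c : ZMod Λ, |g ν c| ≤ 1260 * (max 1 s) ^ (-(1 / 2 : ℝ)) := by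
    simp only [hg, if_true]; exact sum_abs_fwdDiff_torusHeatKernel_le hs
  have hrest : ∏ i ∈ Finset.univ.erase ν, ∑ c : ZMod Λ, |g i c| ≤ (48 : ℝ) ^ D := by
    calc ∏ i ∈ Finset.univ.erase ν, ∑ c : ZMod Λ, |g i c| ≤ ∏ _i ∈ Finset.univ.erase ν, (48 : ℝ) :=
          Finset.prod_le_prod (fun i _ => Finset.sum_nonneg fun c _ => abs_nonneg _) fun i hi => by
            simp only [hg, Finset.ne_of_mem_erase hi, if_false]; exact sum_abs_torusHeatKernel_le hs
      _ = 48 ^ (D - 1) := by rw [Finset.prod_const, Finset.card_erase_of_mem (Finset.mem_univ ν), Finset.card_univ, Fintype.card_fin]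
      _ ≤ 48 ^ D := pow_le_pow_right₀ (by norm_num) (Nat.sub_le D 1)
  have h48 : (0 : ℝ) ≤ ∏ i ∈ Finset.univ.erase ν, ∑ c : ZMod Λ, |g i c| := Finset.prod_nonneg fun i _ => Finset.sum_nonneg fun c _ => abs_nonneg _
  calc (∑ c : ZMod Λ, |g ν c|) * ∏ i ∈ Finset.univ.erase ν, ∑ c : ZMod Λ, |g i c|
      ≤ (1260 * (max 1 s) ^ (-(1 / 2 : ℝ))) * (48 : ℝ) ^ D := mul_le_mul hν hrest h48 (by positivity)
    _ = 1260 * (48 : ℝ) ^ D * (max 1 s) ^ (-(1 / 2 : ℝ)) := by ring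

/-- [folklore] the BACKWARD difference has the same `ℓ¹` norm: `Σ_z |K_s(z − e_ν) − K_s(z)| ≤ 1260·48^D·(1∨s)^{−1∕2}`. -/
theorem sum_abs_bwdDiff_prodHeat_le {s : ℝ} (hs : 0 < s) (ν : Fin D) :
    ∑ z : TorusSite D Λ, |(∏ i, torusHeatKernel s ((z - Pi.single ν 1 : TorusSite D Λ) i)) - ∏ i, torusHeatKernel s (z i)|
      ≤ 1260 * (48 : ℝ) ^ D * (max 1 s) ^ (-(1 / 2 : ℝ)) := by
  have h := sum_abs_fwdDiff_prodHeat_le (Λ := Λ) hs ν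
  refine le_of_eq_of_le ?_ h
  refine Fintype.sum_equiv (Equiv.subRight (Pi.single ν 1 : TorusSite D Λ)) _ _ fun z => ?_
  simp only [Equiv.subRight_apply, sub_add_cancel]
  exact abs_sub_comm _ _

/-! ## §4 Second and third mixed differences through the semigroup -/

/-- [folklore] **SECOND MIXED DIFFERENCES IN `ℓ¹`**: with `K_s(z) = Π_i q^Λ_s(z_i)`,
`Σ_z |K_{2s}(z+e_ν+e_μ) − K_{2s}(z+e_ν) − K_{2s}(z+e_μ) + K_{2s}(z)| ≤ (1260·48^D·(1∨s)^{−1∕2})²` — `K_{2s} = K_s ∗ K_s`, one difference on each factor, Young. -/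
theorem sum_abs_diff₂_prodHeat_le {s : ℝ} (hs : 0 < s) (ν μ : Fin D) :
    ∑ z : TorusSite D Λ, |(∏ i, torusHeatKernel (s + s) ((z + Pi.single ν 1 + Pi.single μ 1 : TorusSite D Λ) i))
        - (∏ i, torusHeatKernel (s + s) ((z + Pi.single ν 1 : TorusSite D Λ) i))
        - (∏ i, torusHeatKernel (s + s) ((z + Pi.single μ 1 : TorusSite D Λ) i)) + ∏ i, torusHeatKernel (s + s) (z i)|
      ≤ (1260 * (48 : ℝ) ^ D * (max 1 s) ^ (-(1 / 2 : ℝ))) ^ 2 := by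
  set f : TorusSite D Λ → ℝ := fun z => ∏ i, torusHeatKernel s (z i) with hf
  set fμ : TorusSite D Λ → ℝ := fun z => f (z + Pi.single μ 1) - f z with hfμ
  set fν : TorusSite D Λ → ℝ := fun z => f (z + Pi.single ν 1) - f z with hfν
  -- the semigroup: K_{2s}(y) = Σ_w f(y − w) f(w)
  have hK : ∀ y : TorusSite D Λ, ∏ i, torusHeatKernel (s + s) (y i) = ∑ w, f (y - w) * f w := fun y => by
    rw [← prodHeat_conv s s y]
  -- the mixed difference is the convolution of the two differences
  have hdd : ∀ z : TorusSite D Λ,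
      (∏ i, torusHeatKernel (s + s) ((z + Pi.single ν 1 + Pi.single μ 1 : TorusSite D Λ) i))
        - (∏ i, torusHeatKernel (s + s) ((z + Pi.single ν 1 : TorusSite D Λ) i))
        - (∏ i, torusHeatKernel (s + s) ((z + Pi.single μ 1 : TorusSite D Λ) i)) + ∏ i, torusHeatKernel (s + s) (z i)
      = ∑ w, fμ (z - w) * fν w := by
    intro z
    rw [hK, hK, hK, hK]
    -- move the ν-shift onto the second factor, keep the μ-shift on the first
    rw [show (z + Pi.single ν 1 + Pi.single μ 1 : TorusSite D Λ) = (z + Pi.single μ 1) + Pi.single ν 1 by abel,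
      conv_shift f f (Pi.single ν 1) (z + Pi.single μ 1), conv_shift f f (Pi.single ν 1) z]
    simp only [hfμ, hfν, ← Finset.sum_sub_distrib, ← Finset.sum_add_distrib]
    refine Finset.sum_congr rfl fun w _ => ?_
    rw [show z + Pi.single μ 1 - w = z - w + Pi.single μ 1 by abel]
    ring
  simp_rw [hdd]
  have h1 : ∑ z, |fμ z| ≤ 1260 * (48 : ℝ) ^ D * (max 1 s) ^ (-(1 / 2 : ℝ)) := sum_abs_fwdDiff_prodHeat_le hs μ
  have h2 : ∑ z, |fν z| ≤ 1260 * (48 : ℝ) ^ D * (max 1 s) ^ (-(1 / 2 : ℝ)) := sum_abs_fwdDiff_prodHeat_le hs ν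
  have h0 : (0 : ℝ) ≤ ∑ z, |fν z| := Finset.sum_nonneg fun z _ => abs_nonneg _
  calc ∑ z : TorusSite D Λ, |∑ w, fμ (z - w) * fν w| ≤ (∑ z, |fμ z|) * ∑ w, |fν w| := sum_abs_conv_le fμ fν
    _ ≤ (1260 * (48 : ℝ) ^ D * (max 1 s) ^ (-(1 / 2 : ℝ))) * (1260 * (48 : ℝ) ^ D * (max 1 s) ^ (-(1 / 2 : ℝ))) :=
        mul_le_mul h1 h2 h0 (by positivity)
    _ = _ := by ring

/-- [folklore] **THIRD MIXED DIFFERENCES IN `ℓ¹`** (two forward in `z`, one backward — the shape `(S_ν−1)·∂_μ·F·∂_{μ′}ᴴ` produces):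
`Σ_z |D_νD_μD⁻_{μ′}K_{3s}(z)| ≤ (1260·48^D·(1∨s)^{−1∕2})³`, `K_{3s} = K_{2s} ∗ K_s`, `D⁻g(w) = g(w − e_{μ′}) − g(w)`. -/
theorem sum_abs_diff₃_prodHeat_le {s : ℝ} (hs : 0 < s) (ν μ μ' : Fin D) :
    ∑ z : TorusSite D Λ,
      |((∏ i, torusHeatKernel (s + s + s) ((z - Pi.single μ' 1 + Pi.single ν 1 + Pi.single μ 1 : TorusSite D Λ) i))
          - (∏ i, torusHeatKernel (s + s + s) ((z - Pi.single μ' 1 + Pi.single ν 1 : TorusSite D Λ) i))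
          - (∏ i, torusHeatKernel (s + s + s) ((z - Pi.single μ' 1 + Pi.single μ 1 : TorusSite D Λ) i))
          + ∏ i, torusHeatKernel (s + s + s) ((z - Pi.single μ' 1 : TorusSite D Λ) i))
        - ((∏ i, torusHeatKernel (s + s + s) ((z + Pi.single ν 1 + Pi.single μ 1 : TorusSite D Λ) i))
          - (∏ i, torusHeatKernel (s + s + s) ((z + Pi.single ν 1 : TorusSite D Λ) i))
          - (∏ i, torusHeatKernel (s + s + s) ((z + Pi.single μ 1 : TorusSite D Λ) i))
          + ∏ i, torusHeatKernel (s + s + s) (z i))|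
      ≤ (1260 * (48 : ℝ) ^ D * (max 1 s) ^ (-(1 / 2 : ℝ))) ^ 3 := by
  set g : TorusSite D Λ → ℝ := fun z => ∏ i, torusHeatKernel s (z i) with hg
  set F : TorusSite D Λ → ℝ := fun z => ∏ i, torusHeatKernel (s + s) (z i) with hF
  set F2 : TorusSite D Λ → ℝ := fun z => F (z + Pi.single ν 1 + Pi.single μ 1) - F (z + Pi.single ν 1) - F (z + Pi.single μ 1) + F z with hF2
  set gb : TorusSite D Λ → ℝ := fun w => g (w - Pi.single μ' 1) - g w with hgb
  -- the semigroup: K_{3s}(y) = Σ_w F(y − w) g(w)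
  have hK : ∀ y : TorusSite D Λ, ∏ i, torusHeatKernel (s + s + s) (y i) = ∑ w, F (y - w) * g w := fun y => by
    rw [← prodHeat_conv (s + s) s y]
  -- the second forward difference of a convolution in `z` falls on the first factor
  have hF2conv : ∀ y : TorusSite D Λ,
      (∑ w, F (y + Pi.single ν 1 + Pi.single μ 1 - w) * g w) - (∑ w, F (y + Pi.single ν 1 - w) * g w)
        - (∑ w, F (y + Pi.single μ 1 - w) * g w) + (∑ w, F (y - w) * g w) = ∑ w, F2 (y - w) * g w := by
    intro y
    simp only [hF2, ← Finset.sum_sub_distrib, ← Finset.sum_add_distrib]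
    refine Finset.sum_congr rfl fun w _ => ?_
    rw [show y + Pi.single ν 1 + Pi.single μ 1 - w = y - w + Pi.single ν 1 + Pi.single μ 1 by abel,
      show y + Pi.single ν 1 - w = y - w + Pi.single ν 1 by abel, show y + Pi.single μ 1 - w = y - w + Pi.single μ 1 by abel]
    ring
  -- the backward shift of `z` moves onto the second factor
  have hshift : ∀ w' : TorusSite D Λ, ∑ w, F2 (w' - Pi.single μ' 1 - w) * g w = ∑ w, F2 (w' - w) * g (w - Pi.single μ' 1) := by
    intro w'
    rw [sub_eq_add_neg w' (Pi.single μ' 1), conv_shift F2 g (-(Pi.single μ' 1 : TorusSite D Λ)) w']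
    simp only [← sub_eq_add_neg]
  have hdd : ∀ z : TorusSite D Λ,
      ((∏ i, torusHeatKernel (s + s + s) ((z - Pi.single μ' 1 + Pi.single ν 1 + Pi.single μ 1 : TorusSite D Λ) i))
          - (∏ i, torusHeatKernel (s + s + s) ((z - Pi.single μ' 1 + Pi.single ν 1 : TorusSite D Λ) i))
          - (∏ i, torusHeatKernel (s + s + s) ((z - Pi.single μ' 1 + Pi.single μ 1 : TorusSite D Λ) i))
          + ∏ i, torusHeatKernel (s + s + s) ((z - Pi.single μ' 1 : TorusSite D Λ) i))
        - ((∏ i, torusHeatKernel (s + s + s) ((z + Pi.single ν 1 + Pi.single μ 1 : TorusSite D Λ) i))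
          - (∏ i, torusHeatKernel (s + s + s) ((z + Pi.single ν 1 : TorusSite D Λ) i))
          - (∏ i, torusHeatKernel (s + s + s) ((z + Pi.single μ 1 : TorusSite D Λ) i))
          + ∏ i, torusHeatKernel (s + s + s) (z i))
      = ∑ w, F2 (z - w) * gb w := by
    intro z
    simp only [hK]
    rw [hF2conv (z - Pi.single μ' 1), hF2conv z, hshift z, ← Finset.sum_sub_distrib]
    refine Finset.sum_congr rfl fun w _ => ?_
    rw [hgb]; ring
  simp_rw [hdd]
  have h1 : ∑ z, |F2 z| ≤ (1260 * (48 : ℝ) ^ D * (max 1 s) ^ (-(1 / 2 : ℝ))) ^ 2 := by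
    simp only [hF2, hF]; exact sum_abs_diff₂_prodHeat_le hs ν μ
  have h2 : ∑ z, |gb z| ≤ 1260 * (48 : ℝ) ^ D * (max 1 s) ^ (-(1 / 2 : ℝ)) := by
    simp only [hgb, hg]; exact sum_abs_bwdDiff_prodHeat_le hs μ'
  have h0 : (0 : ℝ) ≤ ∑ z, |gb z| := Finset.sum_nonneg fun z _ => abs_nonneg _
  calc ∑ z : TorusSite D Λ, |∑ w, F2 (z - w) * gb w| ≤ (∑ z, |F2 z|) * ∑ w, |gb w| := sum_abs_conv_le F2 gb
    _ ≤ (1260 * (48 : ℝ) ^ D * (max 1 s) ^ (-(1 / 2 : ℝ))) ^ 2 * (1260 * (48 : ℝ) ^ D * (max 1 s) ^ (-(1 / 2 : ℝ))) :=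
        mul_le_mul h1 h2 h0 (by positivity)
    _ = _ := by ring

end Summit.QuantumFields.BalabanUV.Beta.FP.TorusHeatSemigroup

end
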